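/-
Copyright (c) 2026 the pub-hodgecm-mathlib formalisation cell (harness21).  Prover seat hodgecm-mathlib-F0P3a-p02 (g23): N8-INNER road, E3a co-hand slice «hgen»
(LH2-plan (g1) 17:22:23Z; pen LH7-p04 (g8), CENSUS-E3a v1 §3), 2026-09-02.
-/
import Literature.NumberTheory.Rogawski1990.ArchEPGeneratorHead        -- ★ E1 (LH7-p01): `EPGeneratorAt` (brings ★ G2 `chartOrbGLoc`, ★ F0 `bzClassMapG`)
import HarnessLib

/-!
# E3a slice «hgen»: the WEIGHTED COMPACT CLAUSE of a one-place EP generator — `(2F(cl)∕h(cl)) · Σ_σ chartOrbGLoc f (c_w ∘ σ) = 2F(cl)`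
# (Shelstad 1979 Lemma 4.2; Rogawski 1990 §8.2, §14.2; Bouaziz 1994 §6.2)

Topic `NumberTheory/Rogawski1990`; namespace `Literature.NumberTheory.Rogawski1990`.  THEOREMS ONLY (no definition, no instance, no notation, no named fact, no `sorry`); kernel
lane `--supports stmt-HodgeConjecture-24833`.  Cell `pub/hodgecm-mathlib`, crux H413 (`stmt-HodgeConjecture-24833`), road «N8-INNER» (LEAD T14-4), brick E3a
`ArchEPAssemblyLocal` (pen LH7-p04 (g8); CENSUS-E3a v1 `F0/P3c/LH7/LH7-p04/g8/e3a/CENSUS-E3a.v1.LH7p04g8.md` §3 «hgen-slice, F0P3a-p02, ONE PLACE, ★-inputs only»): the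
per-place reading that discharges the binder `hgen : ∀ w : {w // p w}, m w * ∑ σ, g w (c w.1 ∘ ⇑σ) = 2 * r w` of ★ E3-CORE p852223 `stableSumG_eq_inv_pow_mul_of_readings`
with the census' letters `m w := 2 * F w cl ∕ h_w (b w) cl`, `g w cw := chartOrbGLoc L β w S (νβw w) (f_w (b w)) cw`, `r w := F w cl`, `cl := bzClassMapG S c w`.  Count-neutral.

THE MATHEMATICS.  At a COMPACT label (`w ∉ S′`) and a regular coordinate (the three phases `e^{i c_w i}` distinct), an EP generator `(ε, f, h)` at the base class `b` (★ E1
`EPGeneratorAt`; chosen on the whole class circle-image by ★ E3b `exists_epGenerator_choice`, with `h ≠ 0` on `ball b ε`) has COMPACT clause `Σ_{σ∈S₃} chartOrbGLoc … f (c_w ∘ σ)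
= h(cl)` whenever `dist cl b < ε`.  For a partition-of-unity factor `F` supported in `ball b ε` (as a function of the class) the weight `m := 2F(cl)∕h(cl)` therefore satisfies
`m · Σ_σ chartOrbGLoc … f (c_w ∘ σ) = 2F(cl)`: if `F(cl) = 0` both sides vanish; otherwise `dist cl b < ε`, the clause fires, `h(cl) ≠ 0`, and `(2F∕h)·h = 2F`.
* **`weightedCompactClause`** — the head (census §3 shape); `F : ℂ³ → ℂ` with the support hypothesis `∀ z, F z ≠ 0 → dist z b < ε` (any `tsupport F ⊆ ball b ε` qualifies:
  `weightedCompactClause_of_tsupport_subset`).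
HONEST LABEL: HC_CM is proved only modulo the 7 printed citations (2 remaining: hLiu418 = `stmt-HodgeConjecture-24832`, h413 = `stmt-HodgeConjecture-24833`) until rung 0 closes;
one-line algebra over ★ E1, pays nothing by itself.

## References
* [Shelstad1979] D. Shelstad, *Characters and inner forms of a quasi-split group over ℝ*, Compositio Math. 39 (1979), Lemma 4.2 p. 23, §4 p. 22.
* [Rogawski1990] J. D. Rogawski, *Automorphic Representations of Unitary Groups in Three Variables*, Ann. of Math. Stud. 123 (1990), §8.2 p. 122, §14.2 (14.2.1) p. 232.
* [Bouaziz1994IntegralesOrbitales] A. Bouaziz, *Intégrales orbitales sur les groupes de Lie réductifs*, Ann. Sci. ÉNS 27 (1994), §6.2 p. 591 (partitions of unity on the class space).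
-/

set_option autoImplicit false

noncomputable section

open MeasureTheory MeasureTheory.Measure NumberField NumberField.InfinitePlace Matrix Complex Topology Metric
open Literature.NumberTheory.Automorphic Literature.NumberTheory.Automorphic.UnitaryGroup Literature.NumberTheory.Automorphic.ArchCartan
open scoped MatrixGroups Matrix ContDiff Classical Matrix.Norms.Operator

namespace Literature.NumberTheory.Rogawski1990

section Gen

variable (L : Type) [Field L] [NumberField L] [IsCMField L] (β : Fin 3 → L) (w : {w : InfinitePlace L // IsComplex w})
  [MeasurableSpace ↥(archLocal L 3 (Matrix.diagonal β) w)] [BorelSpace ↥(archLocal L 3 (Matrix.diagonal β) w)] (νw : Measure ↥(archLocal L 3 (Matrix.diagonal β) w))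
  [νw.IsHaarMeasure] [νw.IsMulRightInvariant]

/-- **THE WEIGHTED COMPACT CLAUSE («hgen» of ★ E3-CORE, one place).**  Given the COMPACT clause of an EP generator `(ε, f, h)` at the class `b` (★ `EPGeneratorAt` ∕ ★
`exists_epGenerator_choice`: at a compact label `w ∉ S′` and a regular coordinate, `Σ_σ chartOrbGLoc … f (c_w ∘ σ) = h(cl)` when `dist cl b < ε`, with `h ≠ 0` on that ball),
and a weight factor `F` vanishing outside `ball b ε`: `(2F(cl)∕h(cl)) · Σ_σ chartOrbGLoc … f (c_w ∘ σ) = 2F(cl)`, `cl = bzClassMapG S′ c w` — both sides `0` off the support,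
`(2F∕h)·h` on it. [cite: Shelstad1979, Lemma 4.2 p. 23] [cite: Rogawski1990, §14.2 (14.2.1) p. 232] [cite: Bouaziz1994IntegralesOrbitales, §6.2 p. 591] -/
theorem weightedCompactClause {ε : ℝ} {b : ℂ × ℂ × ℂ} {f : ↥(archLocal L 3 (Matrix.diagonal β) w) → ℂ} {h : ℂ × ℂ × ℂ → ℂ}
    (hh0 : ∀ z, dist z b < ε → h z ≠ 0)
    (hcpt : ∀ (S' : Finset {w : InfinitePlace L // IsComplex w}) (c : {w : InfinitePlace L // IsComplex w} → Fin 3 → ℝ),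
        w ∉ S' → (Function.Injective fun i : Fin 3 => Circle.exp (c w i)) → dist (bzClassMapG S' c w) b < ε →
          ∑ σ : Equiv.Perm (Fin 3), chartOrbGLoc L β w S' νw f (c w ∘ σ) = h (bzClassMapG S' c w))
    {F : ℂ × ℂ × ℂ → ℂ} (hF : ∀ z, F z ≠ 0 → dist z b < ε)
    {S' : Finset {w : InfinitePlace L // IsComplex w}} {c : {w : InfinitePlace L // IsComplex w} → Fin 3 → ℝ}
    (hw : w ∉ S') (hinj : Function.Injective fun i : Fin 3 => Circle.exp (c w i)) :
    (2 * F (bzClassMapG S' c w) / h (bzClassMapG S' c w)) * ∑ σ : Equiv.Perm (Fin 3), chartOrbGLoc L β w S' νw f (c w ∘ σ) =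
      2 * F (bzClassMapG S' c w) := by
  by_cases hF0 : F (bzClassMapG S' c w) = 0
  · rw [hF0, mul_zero, zero_div, zero_mul]
  · have hd : dist (bzClassMapG S' c w) b < ε := hF _ hF0
    rw [hcpt S' c hw hinj hd, div_mul_cancel₀ _ (hh0 _ hd)]

/-- The same with the support hypothesis as `tsupport F ⊆ ball b ε` (the partition-of-unity factor's currency). [cite: Bouaziz1994IntegralesOrbitales, §6.2 p. 591] -/
theorem weightedCompactClause_of_tsupport_subset {ε : ℝ} {b : ℂ × ℂ × ℂ} {f : ↥(archLocal L 3 (Matrix.diagonal β) w) → ℂ} {h : ℂ × ℂ × ℂ → ℂ}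
    (hh0 : ∀ z, dist z b < ε → h z ≠ 0)
    (hcpt : ∀ (S' : Finset {w : InfinitePlace L // IsComplex w}) (c : {w : InfinitePlace L // IsComplex w} → Fin 3 → ℝ),
        w ∉ S' → (Function.Injective fun i : Fin 3 => Circle.exp (c w i)) → dist (bzClassMapG S' c w) b < ε →
          ∑ σ : Equiv.Perm (Fin 3), chartOrbGLoc L β w S' νw f (c w ∘ σ) = h (bzClassMapG S' c w))
    {F : ℂ × ℂ × ℂ → ℂ} (hF : tsupport F ⊆ Metric.ball b ε)
    {S' : Finset {w : InfinitePlace L // IsComplex w}} {c : {w : InfinitePlace L // IsComplex w} → Fin 3 → ℝ}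
    (hw : w ∉ S') (hinj : Function.Injective fun i : Fin 3 => Circle.exp (c w i)) :
    (2 * F (bzClassMapG S' c w) / h (bzClassMapG S' c w)) * ∑ σ : Equiv.Perm (Fin 3), chartOrbGLoc L β w S' νw f (c w ∘ σ) =
      2 * F (bzClassMapG S' c w) :=
  weightedCompactClause L β w νw hh0 hcpt (fun _ hz => Metric.mem_ball.1 (hF (subset_tsupport F (Function.mem_support.2 hz)))) hw hinj

/-- **The «hgen» binder of ★ E3-CORE at one place, in its letters**: with `m := 2 * F cl ∕ h cl`, `g cw := chartOrbGLoc … f cw`, `r := F cl`: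
`m * Σ_σ g (c w ∘ σ) = 2 * r`. [cite: Shelstad1979, Lemma 4.2 p. 23] [cite: Rogawski1990, §14.2 (14.2.1) p. 232] -/
theorem weightedCompactClause_letters {ε : ℝ} {b : ℂ × ℂ × ℂ} {f : ↥(archLocal L 3 (Matrix.diagonal β) w) → ℂ} {h : ℂ × ℂ × ℂ → ℂ}
    (hh0 : ∀ z, dist z b < ε → h z ≠ 0)
    (hcpt : ∀ (S' : Finset {w : InfinitePlace L // IsComplex w}) (c : {w : InfinitePlace L // IsComplex w} → Fin 3 → ℝ),
        w ∉ S' → (Function.Injective fun i : Fin 3 => Circle.exp (c w i)) → dist (bzClassMapG S' c w) b < ε →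
          ∑ σ : Equiv.Perm (Fin 3), chartOrbGLoc L β w S' νw f (c w ∘ σ) = h (bzClassMapG S' c w))
    {F : ℂ × ℂ × ℂ → ℂ} (hF : ∀ z, F z ≠ 0 → dist z b < ε)
    {S' : Finset {w : InfinitePlace L // IsComplex w}} {c : {w : InfinitePlace L // IsComplex w} → Fin 3 → ℝ}
    (hw : w ∉ S') (hinj : Function.Injective fun i : Fin 3 => Circle.exp (c w i))
    {m r : ℂ} {g : (Fin 3 → ℝ) → ℂ} (hm : m = 2 * F (bzClassMapG S' c w) / h (bzClassMapG S' c w)) (hr : r = F (bzClassMapG S' c w))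
    (hg : ∀ cw, g cw = chartOrbGLoc L β w S' νw f cw) :
    m * ∑ σ : Equiv.Perm (Fin 3), g (c w ∘ σ) = 2 * r := by
  simp only [hg, hm, hr]
  exact weightedCompactClause L β w νw hh0 hcpt hF hw hinj

end Gen

end Literature.NumberTheory.Rogawski1990

end
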